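import Summits.NavierStokesRegularity.NavierStokesRegularity.Theorems.SoloRefuteSchatz2025WindJetCKN

/-!
# C171 `Schatz2025` — wind-jet refutation of the local face `Step_M1_local` — part 5/6: the real inequality

Cell `ns-claims` (D-0090), row C171 `Schatz2025` (locator =
the LANDED skeleton `Literature.Claims.NS.Schatz2025`, text of record as cited in its module docstring). Records-grade ADDENDUM
object of ns-claims-refuter-5 g5 (chair 2026-08-27T18:19Z: records only; row #155 adjudicated at the consumed
head `Step_M1`). Target of the chain: the RECORDED local face
`Literature.Claims.NS.Schatz2025.Step_M1_local` (skeleton l.182; (M.1) p.42 l.2, l.36–38 «F(θr) ≤ κ F(r) + C θ³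
for every suitable weak solution on Q_r(z0)», constants `θ ∈ (0,1/8)`, `κ ∈ (0,1)`, `C ≥ 0` FIRST, then every
open region, every suitable weak solution, every centre and radius with `Q_{2r}(z0) ⊆ Q`).
Main theorem (last file of the chain): `Summit.NavierStokesRegularity.NavierStokesRegularity.Theorems.Schatz2025.not_Step_M1_local`.

THIS FILE (5/6): pure real arithmetic. With `e = (1−κ)/16`, `a = e¹⁰θ²`, `a²U = e⁹θ²(1+e)`, `16 ≤ U`,
`eM ≥ 21600U²`, `M ≥ C+1`, `T ≤ e`: `κ·(UP_A + UP_C) + Cθ³ < LOW` (`main_real_ineq`), where `UP_A`, `UP_C`,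
`LOW` are literally the bounds of part 4 with `w' = e`, `a₂ = a(1−e)`, `w = eθ`. Route: multiply by
`D = 48π²a²U`, closed forms `low_mul_D` / `up_mul_D`, six monomial bounds `≤ (e/2)M³`, the crossing term
`1/(1−e)² ≤ 1+3e` against `κ = 1−16e`, and the scalar inequality
`(1−16e)(π/2+2e)(1+3e) + 7e/2 < (1−e)(π/2−2e)` on `(0, 1/16)`.

WHAT THIS IS NOT: not a claim about NS regularity or blow-up; not a claim about any author beyond the typed
locator.
-/

-- lint debt (cell convention, SoloRefute files): the Theorems namespace repeats `NavierStokesRegularity`.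
set_option linter.dupNamespace false

noncomputable section

open Set Function MeasureTheory Filter TopologicalSpace Metric Real
open scoped Topology ContDiff ENNReal RealInnerProductSpace Laplacian

namespace Summit.NavierStokesRegularity.NavierStokesRegularity.Theorems.Schatz2025

open Literature.Analysis.FluidPDE Literature.Analysis.UnboundedOperators


/-! ## E. Parameters, the real inequality, and the refutation of `Step_M1_local` -/

/-- `e^{-x} ≤ 1/x` for `x > 0`. [folklore] -/
theorem exp_neg_le_inv {x : ℝ} (hx : 0 < x) : exp (-x) ≤ x⁻¹ := by
  rw [Real.exp_neg]
  exact inv_anti₀ hx ((le_add_of_nonneg_right zero_le_one).trans (Real.add_one_le_exp x))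

/-- The Gaussian tail at the chosen disc radius `w = eθ` and birth time `a = e¹⁰θ²` is at most `e`.
[folklore] -/
theorem tail_le {e θ a : ℝ} (he : 0 < e) (he1 : e < 1 / 16) (hθ : 0 < θ) (ha : a = e ^ 10 * θ ^ 2) :
    2 * exp (-(3 * (e * θ) ^ 2) / (8 * a)) ≤ e := by
  have he' : e ≠ 0 := he.ne'
  have hθ' : θ ≠ 0 := hθ.ne'
  have hx : -(3 * (e * θ) ^ 2) / (8 * a) = -(3 / (8 * e ^ 8)) := by
    rw [ha]; field_simp
  rw [hx]
  have h8 : 0 < 3 / (8 * e ^ 8) := by positivity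
  have h7 : e ^ 7 ≤ (1 / 16) ^ 7 := pow_le_pow_left₀ he.le he1.le 7
  calc 2 * exp (-(3 / (8 * e ^ 8))) ≤ 2 * (3 / (8 * e ^ 8))⁻¹ :=
        mul_le_mul_of_nonneg_left (exp_neg_le_inv h8) (by norm_num)
    _ = (16 / 3 * e ^ 7) * e := by field_simp; ring
    _ ≤ 1 * e := by
        refine mul_le_mul_of_nonneg_right ?_ he.le
        nlinarith
    _ = e := one_mul e

section RealInequality
variable {θ C e a U M : ℝ}

/-- Numerical bounds on `π` used below. [folklore] -/
theorem pi_cube_lt : π ^ 3 < 31.26 := by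
  have h0 : 0 < π := Real.pi_pos
  have h1 : π < 3.15 := Real.pi_lt_d2
  nlinarith [mul_pos h0 h0]

/-- `π² < 9.93`. [folklore] -/
theorem pi_sq_lt : π ^ 2 < 9.93 := by
  have h0 : 0 < π := Real.pi_pos
  have h1 : π < 3.15 := Real.pi_lt_d2
  nlinarith

/-- Master bounds: `2001 M² ≤ (e/2) M³` and `2001 M ≤ (e/2) M³`. [folklore] -/
theorem master_bounds (he1 : e < 1 / 16) (hU1 : 16 ≤ U) (hM1 : 1 ≤ M)
    (hMU : 21600 * U ^ 2 ≤ e * M) :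
    2001 * M ^ 2 ≤ e / 2 * M ^ 3 ∧ 2001 * M ≤ e / 2 * M ^ 3 := by
  have hM0 : 0 < M := by linarith
  have hU2 : 256 ≤ U ^ 2 := by nlinarith
  have heM : 4002 ≤ e * M := by linarith
  have hMM : M ≤ M ^ 2 := by nlinarith
  have hkey : 2001 * M ^ 2 ≤ e / 2 * M ^ 3 := by
    have h := mul_le_mul_of_nonneg_right heM (sq_nonneg M)
    have h' : e * M * M ^ 2 = e * M ^ 3 := by ring
    rw [h'] at h
    linarith
  refine ⟨hkey, ?_⟩
  have := mul_le_mul_of_nonneg_left hMM (by norm_num : (0:ℝ) ≤ 2001)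
  linarith

/-- `e⁹ θ² (1+e) ≤ 1`. [folklore] -/
theorem small_coeff (hθ : 0 < θ) (hθ1 : θ < 1 / 8) (he0 : 0 < e) (he1 : e < 1 / 16) :
    e ^ 9 * θ ^ 2 * (1 + e) ≤ 1 := by
  have h9 : e ^ 9 ≤ 1 := pow_le_one₀ he0.le (by linarith)
  have h1 : e ^ 9 * θ ^ 2 ≤ 1 / 64 := by
    calc e ^ 9 * θ ^ 2 ≤ 1 * θ ^ 2 := mul_le_mul_of_nonneg_right h9 (sq_nonneg θ)
      _ ≤ 1 / 64 := by nlinarith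
  have h2 : e ^ 9 * θ ^ 2 * (1 + e) ≤ 1 / 64 * 2 :=
    mul_le_mul h1 (by linarith) (by linarith) (by norm_num)
  linarith

/-- Monomial bound 1 of 6 for `up_mul_D` (the `U²`-term of `cknA 1` times `D = 48π²a²U`), as displayed. [folklore] -/
theorem bound_b1 (hθ : 0 < θ) (hθ1 : θ < 1 / 8) (he0 : 0 < e) (he1 : e < 1 / 16)
    (hU1 : 16 ≤ U) (hM1 : 1 ≤ M) (hMU : 21600 * U ^ 2 ≤ e * M) :
    64 * π ^ 3 * (e ^ 9 * θ ^ 2 * (1 + e) * U ^ 2) ≤ e / 2 * M ^ 3 := by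
  have hπ := pi_cube_lt
  have hM0 : 0 < M := by linarith
  have hkey' := (master_bounds he1 hU1 hM1 hMU).2
  have hM2 : 21600 * U ^ 2 ≤ M := hMU.trans (mul_le_of_le_one_left hM0.le (by linarith))
  have hπU : π ^ 3 * U ^ 2 ≤ 31.26 * U ^ 2 := mul_le_mul_of_nonneg_right hπ.le (sq_nonneg U)
  have h1 : e ^ 9 * θ ^ 2 * (1 + e) * U ^ 2 ≤ U ^ 2 := by
    have := mul_le_mul_of_nonneg_right (small_coeff hθ hθ1 he0 he1) (sq_nonneg U); linarith
  have s1 : 64 * π ^ 3 * (e ^ 9 * θ ^ 2 * (1 + e) * U ^ 2) ≤ 64 * π ^ 3 * U ^ 2 :=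
    mul_le_mul_of_nonneg_left h1 (by positivity)
  linarith

/-- Monomial bound 2 of 6 (the `(M a⁻¹)²`-term of `cknA 1` times `D`). [folklore] -/
theorem bound_b2 (hU1 : 16 ≤ U) (hMU : 21600 * U ^ 2 ≤ e * M) :
    64 * π ^ 3 * (U * M ^ 2) ≤ e / 2 * M ^ 3 := by
  have hπ := pi_cube_lt
  have hU0 : 0 < U := by linarith
  have hUU : U ≤ U ^ 2 := by nlinarith
  have hπU1 : π ^ 3 * U ≤ 31.26 * U := mul_le_mul_of_nonneg_right hπ.le hU0.le
  have h1 : 128 * π ^ 3 * U ≤ e * M := by linarith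
  have h := mul_le_mul_of_nonneg_right h1 (sq_nonneg M)
  have h' : e * M * M ^ 2 = e * M ^ 3 := by ring
  have h'' : 128 * π ^ 3 * U * M ^ 2 = 2 * (64 * π ^ 3 * (U * M ^ 2)) := by ring
  rw [h', h''] at h
  linarith

/-- Monomial bound 3 of 6 (the `U³`-term of `cknC 1` times `D`). [folklore] -/
theorem bound_b3 (hθ : 0 < θ) (hθ1 : θ < 1 / 8) (he0 : 0 < e) (he1 : e < 1 / 16)
    (hU1 : 16 ≤ U) (hM1 : 1 ≤ M) (hMU : 21600 * U ^ 2 ≤ e * M) :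
    64 * π ^ 3 * (e ^ 9 * θ ^ 2 * (1 + e) * U ^ 3) ≤ e / 2 * M ^ 3 := by
  have hπ := pi_cube_lt
  have hU0 : 0 < U := by linarith
  have hM0 : 0 < M := by linarith
  have hkey := (master_bounds he1 hU1 hM1 hMU).1
  have hM2 : 21600 * U ^ 2 ≤ M := hMU.trans (mul_le_of_le_one_left hM0.le (by linarith))
  have hUU : U ≤ U ^ 2 := by nlinarith
  have hUM : U ≤ M := by linarith
  have hU2M : U ^ 2 ≤ M := by linarith
  have hπU3 : π ^ 3 * U ^ 3 ≤ 31.26 * U ^ 3 :=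
    mul_le_mul_of_nonneg_right hπ.le (pow_nonneg hU0.le 3)
  have h1 : e ^ 9 * θ ^ 2 * (1 + e) * U ^ 3 ≤ U ^ 3 := by
    have := mul_le_mul_of_nonneg_right (small_coeff hθ hθ1 he0 he1) (pow_nonneg hU0.le 3)
    linarith
  have s1 : 64 * π ^ 3 * (e ^ 9 * θ ^ 2 * (1 + e) * U ^ 3) ≤ 64 * π ^ 3 * U ^ 3 :=
    mul_le_mul_of_nonneg_left h1 (by positivity)
  have hU3 : 0 ≤ U ^ 3 := by positivity
  have s3 : U ^ 3 ≤ U * M := by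
    have h := mul_le_mul_of_nonneg_left hU2M hU0.le
    have h' : U * U ^ 2 = U ^ 3 := by ring
    rw [h'] at h; exact h
  have s4 : U * M ≤ M ^ 2 := by
    have h := mul_le_mul_of_nonneg_right hUM hM0.le
    have h' : M * M = M ^ 2 := by ring
    rw [h'] at h; exact h
  linarith

/-- Monomial bound 4 of 6 (the `3U²(M a⁻¹)`-term of `cknC 1` times `D`). [folklore] -/
theorem bound_b4 (he1 : e < 1 / 16) (hU1 : 16 ≤ U) (hM1 : 1 ≤ M)
    (hMU : 21600 * U ^ 2 ≤ e * M) (ha1 : a ≤ 1) :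
    64 * π ^ 3 * (3 * a * U ^ 3 * M) ≤ e / 2 * M ^ 3 := by
  have hπ := pi_cube_lt
  have hU0 : 0 < U := by linarith
  have hM0 : 0 < M := by linarith
  have hM2 : 21600 * U ^ 2 ≤ M := hMU.trans (mul_le_of_le_one_left hM0.le (by linarith))
  have hUU : U ≤ U ^ 2 := by nlinarith
  have hUM : U ≤ M := by linarith
  have hπU3 : π ^ 3 * U ^ 3 ≤ 31.26 * U ^ 3 :=
    mul_le_mul_of_nonneg_right hπ.le (pow_nonneg hU0.le 3)
  have h1 : a * U ^ 3 ≤ U ^ 3 := mul_le_of_le_one_left (pow_nonneg hU0.le 3) ha1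
  have h1' : 64 * π ^ 3 * (3 * a * U ^ 3 * M) ≤ 64 * π ^ 3 * (3 * U ^ 3 * M) := by
    have h := mul_le_mul_of_nonneg_right h1 hM0.le
    have h2 := mul_le_mul_of_nonneg_left h (by positivity : (0:ℝ) ≤ 192 * π ^ 3)
    have e1 : 192 * π ^ 3 * (a * U ^ 3 * M) = 64 * π ^ 3 * (3 * a * U ^ 3 * M) := by ring
    have e2 : 192 * π ^ 3 * (U ^ 3 * M) = 64 * π ^ 3 * (3 * U ^ 3 * M) := by ring
    rw [e1, e2] at h2; exact h2
  have h2 : 384 * π ^ 3 * U ^ 3 ≤ e * M ^ 2 := by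
    have h22 : 21600 * U ^ 2 * M ≤ (e * M) * M := mul_le_mul_of_nonneg_right hMU hM0.le
    have h23 : U ^ 2 * U ≤ U ^ 2 * M := mul_le_mul_of_nonneg_left hUM (sq_nonneg U)
    have e1 : U ^ 2 * U = U ^ 3 := by ring
    have e2 : e * M * M = e * M ^ 2 := by ring
    rw [e1] at h23; rw [e2] at h22
    have : 0 ≤ U ^ 2 * M := by positivity
    linarith
  have h3 := mul_le_mul_of_nonneg_right h2 hM0.le
  have e3 : e * M ^ 2 * M = e * M ^ 3 := by ring
  have e4 : 384 * π ^ 3 * U ^ 3 * M = 2 * (64 * π ^ 3 * (3 * U ^ 3 * M)) := by ring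
  rw [e3, e4] at h3
  linarith

/-- Monomial bound 5 of 6 (the `3U(M a⁻¹)²`-term of `cknC 1` times `D`). [folklore] -/
theorem bound_b5 (hMU : 21600 * U ^ 2 ≤ e * M) :
    64 * π ^ 3 * (3 * U ^ 2 * M ^ 2) ≤ e / 2 * M ^ 3 := by
  have hπ := pi_cube_lt
  have hU2 := sq_nonneg U
  have hπU : π ^ 3 * U ^ 2 ≤ 31.26 * U ^ 2 := mul_le_mul_of_nonneg_right hπ.le (sq_nonneg U)
  have h1 : 384 * π ^ 3 * U ^ 2 ≤ e * M := by linarith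
  have h := mul_le_mul_of_nonneg_right h1 (sq_nonneg M)
  have e1 : e * M * M ^ 2 = e * M ^ 3 := by ring
  have e2 : 384 * π ^ 3 * U ^ 2 * M ^ 2 = 2 * (64 * π ^ 3 * (3 * U ^ 2 * M ^ 2)) := by ring
  rw [e1, e2] at h
  linarith

/-- Monomial bound 6 of 6 (the far-field column term `M³(πe²)⁻³·2π` times `D`). [folklore] -/
theorem bound_b6 (hθ : 0 < θ) (hθ1 : θ < 1 / 8) (he0 : 0 < e) (he1 : e < 1 / 16)
    (hM1 : 1 ≤ M) : M ^ 3 * (96 * (e ^ 9 * θ ^ 2 * (1 + e)) / e ^ 6) ≤ e / 2 * M ^ 3 := by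
  have hM0 : 0 < M := by linarith
  have hM3 : 0 < M ^ 3 := by positivity
  have he' : e ≠ 0 := he0.ne'
  have h1 : 96 * (e ^ 9 * θ ^ 2 * (1 + e)) / e ^ 6 = 96 * e ^ 2 * θ ^ 2 * (1 + e) * e := by
    field_simp
    try ring
  rw [h1]
  have h2 : 96 * e ^ 2 * θ ^ 2 * (1 + e) ≤ 1 / 2 := by
    have he2 : e ^ 2 ≤ 1 / 256 := by nlinarith
    have hθ2 : θ ^ 2 ≤ 1 / 64 := by nlinarith
    have h3 : e ^ 2 * θ ^ 2 ≤ 1 / 256 * (1 / 64) :=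
      mul_le_mul he2 hθ2 (sq_nonneg θ) (by norm_num)
    have h4 : e ^ 2 * θ ^ 2 * (1 + e) ≤ 1 / 256 * (1 / 64) * 2 :=
      mul_le_mul h3 (by linarith) (by linarith) (by norm_num)
    linarith
  have h3 := mul_le_mul_of_nonneg_right h2 (mul_pos he0 hM3).le
  have e1 : 96 * e ^ 2 * θ ^ 2 * (1 + e) * (e * M ^ 3) =
      M ^ 3 * (96 * e ^ 2 * θ ^ 2 * (1 + e) * e) := by ring
  have e2 : 1 / 2 * (e * M ^ 3) = e / 2 * M ^ 3 := by ring
  rw [e1, e2] at h3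
  exact h3

/-- The polynomial (in `U`, `M`) part of the upper bound is at most `3e M³`. [folklore] -/
theorem poly_bounds (hθ : 0 < θ) (hθ1 : θ < 1 / 8) (he0 : 0 < e) (he1 : e < 1 / 16)
    (hU1 : 16 ≤ U) (hM1 : 1 ≤ M) (hMU : 21600 * U ^ 2 ≤ e * M) (ha1 : a ≤ 1) :
    64 * π ^ 3 * (e ^ 9 * θ ^ 2 * (1 + e) * U ^ 2 + U * M ^ 2) +
      (64 * π ^ 3 * (e ^ 9 * θ ^ 2 * (1 + e) * U ^ 3 + 3 * a * U ^ 3 * M + 3 * U ^ 2 * M ^ 2) +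
        M ^ 3 * (96 * (e ^ 9 * θ ^ 2 * (1 + e)) / e ^ 6)) ≤ 3 * e * M ^ 3 := by
  have b1 := bound_b1 hθ hθ1 he0 he1 hU1 hM1 hMU
  have b2 := bound_b2 hU1 hMU
  have b3 := bound_b3 hθ hθ1 he0 he1 hU1 hM1 hMU
  have b4 := bound_b4 he1 hU1 hM1 hMU ha1
  have b5 := bound_b5 (e := e) hMU
  have b6 := bound_b6 hθ hθ1 he0 he1 hM1
  linarith

/-- The `Cθ³` term is negligible: `48π² C θ³ (a²U) ≤ (e/2) M³`. [folklore] -/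
theorem cterm_bound (hθ : 0 < θ) (hθ1 : θ < 1 / 8) (hC : 0 ≤ C) (he0 : 0 < e) (he1 : e < 1 / 16)
    (hM1 : 1 ≤ M) (hMC : C + 1 ≤ M) :
    48 * π ^ 2 * C * θ ^ 3 * (e ^ 9 * θ ^ 2 * (1 + e)) ≤ e / 2 * M ^ 3 := by
  have hπ := pi_sq_lt
  have hM0 : 0 < M := by linarith
  have hMM : M ≤ M ^ 2 := by nlinarith
  have hM3 : 0 < M ^ 3 := by positivity
  have hθ3 : θ ^ 3 ≤ 1 := pow_le_one₀ hθ.le (by linarith)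
  have h1 : 48 * π ^ 2 * C * θ ^ 3 * (e ^ 9 * θ ^ 2 * (1 + e)) ≤ 954 * C * e ^ 9 := by
    have h11 : e ^ 9 * θ ^ 2 * (1 + e) ≤ 2 * e ^ 9 := by
      have : θ ^ 2 * (1 + e) ≤ 2 := by nlinarith
      nlinarith [pow_pos he0 9]
    have h12 : C * θ ^ 3 ≤ C := mul_le_of_le_one_right hC hθ3
    have h13 : 0 ≤ C * θ ^ 3 := by positivity
    have h14 : C * θ ^ 3 * (e ^ 9 * θ ^ 2 * (1 + e)) ≤ C * (2 * e ^ 9) :=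
      mul_le_mul h12 h11 (by positivity) hC
    have h15 : π ^ 2 * (C * θ ^ 3 * (e ^ 9 * θ ^ 2 * (1 + e))) ≤ 9.93 * (C * (2 * e ^ 9)) :=
      mul_le_mul hπ.le h14 (by positivity) (by norm_num)
    have h16 : 0 ≤ C * e ^ 9 := by positivity
    nlinarith
  have h2 : 954 * C * e ^ 9 ≤ e / 2 * M ^ 3 := by
    have h21 : e ^ 8 ≤ (1 / 16) ^ 8 := pow_le_pow_left₀ he0.le he1.le 8
    have h22 : C ≤ M ^ 3 := by nlinarith
    have h23 : 954 * e ^ 9 ≤ e / 2 := by nlinarith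
    nlinarith [mul_le_mul h23 h22 hC (by positivity)]
  linarith

/-- The crossing term against `κ = 1 − 16e`: `1/(1−e)² ≤ 1 + 3e`. [folklore] -/
theorem crossing_bound {κ : ℝ} (he0 : 0 < e) (he1 : e < 1 / 16) (hκe : κ = 1 - 16 * e)
    (hM0 : 0 < M) :
    κ * (M ^ 3 * (π / 2 + 2 * e) / (1 - e) ^ 2) ≤
      M ^ 3 * ((1 - 16 * e) * (π / 2 + 2 * e) * (1 + 3 * e)) := by
  have hπ0 : 0 < π := Real.pi_pos
  have hM3 : 0 < M ^ 3 := by positivity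
  rw [hκe, ← mul_div_assoc, div_le_iff₀ (by nlinarith)]
  have h1 : 1 ≤ (1 + 3 * e) * (1 - e) ^ 2 := by
    nlinarith [mul_pos he0 (show (0:ℝ) < 1 - 5 * e by linarith), pow_pos he0 3]
  have h2 : 0 ≤ M ^ 3 * ((1 - 16 * e) * (π / 2 + 2 * e)) := by
    have : 0 ≤ 1 - 16 * e := by linarith
    positivity
  nlinarith [mul_le_mul_of_nonneg_left h1 h2]

/-- The scalar inequality in `e ∈ (0, 1/16)`:
`(1−16e)(π/2+2e)(1+3e) + 7e/2 < (1−e)(π/2−2e)`. [folklore] -/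
theorem scalar_ineq (he0 : 0 < e) (he1 : e < 1 / 16) :
    (1 - 16 * e) * (π / 2 + 2 * e) * (1 + 3 * e) + 7 / 2 * e < (1 - e) * (π / 2 - 2 * e) := by
  have hπ3 : 3 < π := Real.pi_gt_three
  nlinarith [mul_pos he0 he0, mul_pos (mul_pos he0 he0) he0, mul_pos he0 (by linarith : (0:ℝ) < π - 3)]

/-- Closed form of `LOW · D`, `D = 48π²a²U`. [folklore] -/
theorem low_mul_D {T : ℝ} (hθ : θ ≠ 0) (ha : a ≠ 0) (hU : U ≠ 0) :
    (θ ^ 2)⁻¹ * (M ^ 3 * ((48 * π ^ 2 * a ^ 2)⁻¹ * (1 - T) *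
      ((π * θ ^ 2 / 2 - 2 * θ * (e * θ)) / U))) * (48 * π ^ 2 * a ^ 2 * U) =
      M ^ 3 * ((1 - T) * (π / 2 - 2 * e)) := by
  have hπ : π ≠ 0 := Real.pi_pos.ne'
  field_simp
  try ring

/-- Closed form of `(κ·UP + Cθ³) · D`, `D = 48π²a²U`. [folklore] -/
theorem up_mul_D {κ : ℝ} (ha : a ≠ 0) (hU : U ≠ 0) (he : e ≠ 0) (h1e : 1 - e ≠ 0) :
    (κ * ((U ^ 2 + (M * a⁻¹) ^ 2) * (π * 4 / 3) +
        ((U ^ 3 + 3 * U ^ 2 * (M * a⁻¹) + 3 * U * (M * a⁻¹) ^ 2) * (π * 4 / 3) +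
          M ^ 3 * ((π / 2 + 2 * e) / U * (48 * π ^ 2 * (a * (1 - e)) ^ 2)⁻¹ +
            (π * e ^ 2)⁻¹ ^ 3 * (2 * π)))) + C * θ ^ 3) * (48 * π ^ 2 * a ^ 2 * U) =
      κ * (64 * π ^ 3 * (a ^ 2 * U * U ^ 2 + U * M ^ 2) +
        (64 * π ^ 3 * (a ^ 2 * U * U ^ 3 + 3 * a * U ^ 3 * M + 3 * U ^ 2 * M ^ 2) +
          (M ^ 3 * (π / 2 + 2 * e) / (1 - e) ^ 2 + M ^ 3 * (96 * (a ^ 2 * U) / e ^ 6)))) +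
        48 * π ^ 2 * C * θ ^ 3 * (a ^ 2 * U) := by
  have hπ : π ≠ 0 := Real.pi_pos.ne'
  field_simp
  try ring

/-- **The real inequality**: with `κ = 1 − 16e`, `a = e¹⁰θ²`, `U e a = 1 + e`, `eM ≥ 21600 U²`,
`M ≥ C + 1`, the CKN triple of the wind-jet violates the one-step Morrey improvement:
`κ·(A(1)+C(1)) + Cθ³ < C(θ)` (lower bound of `C(θ)` on the right). [folklore] -/
theorem main_real_ineq {κ T : ℝ} (hκ0 : 0 < κ) (hθ : 0 < θ) (hθ1 : θ < 1 / 8)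
    (hC : 0 ≤ C) (he0 : 0 < e) (he1 : e < 1 / 16) (hκe : κ = 1 - 16 * e)
    (ha0 : 0 < a) (ha1 : a ≤ 1) (hU1 : 16 ≤ U) (hM1 : 1 ≤ M) (hMC : C + 1 ≤ M)
    (hMU : 21600 * U ^ 2 ≤ e * M) (hT : T ≤ e) (ha2U : a ^ 2 * U = e ^ 9 * θ ^ 2 * (1 + e)) :
    κ * ((U ^ 2 + (M * a⁻¹) ^ 2) * (π * 4 / 3) +
        ((U ^ 3 + 3 * U ^ 2 * (M * a⁻¹) + 3 * U * (M * a⁻¹) ^ 2) * (π * 4 / 3) +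
          M ^ 3 * ((π / 2 + 2 * e) / U * (48 * π ^ 2 * (a * (1 - e)) ^ 2)⁻¹ +
            (π * e ^ 2)⁻¹ ^ 3 * (2 * π)))) + C * θ ^ 3 <
      (θ ^ 2)⁻¹ * (M ^ 3 * ((48 * π ^ 2 * a ^ 2)⁻¹ * (1 - T) *
        ((π * θ ^ 2 / 2 - 2 * θ * (e * θ)) / U))) := by
  have hπ0 : 0 < π := Real.pi_pos
  have hπ3 : 3 < π := Real.pi_gt_three
  have hU0 : 0 < U := by linarith
  have hM0 : 0 < M := by linarith
  have hM3 : 0 < M ^ 3 := by positivity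
  have h1e : 0 < 1 - e := by linarith
  have hD : 0 < 48 * π ^ 2 * a ^ 2 * U := by positivity
  refine lt_of_mul_lt_mul_right ?_ hD.le
  rw [low_mul_D hθ.ne' ha0.ne' hU0.ne', up_mul_D ha0.ne' hU0.ne' he0.ne' h1e.ne', ha2U]
  have hpoly := poly_bounds hθ hθ1 he0 he1 hU1 hM1 hMU ha1
  have hc := cterm_bound hθ hθ1 hC he0 he1 hM1 hMC
  have hx := crossing_bound he0 he1 hκe hM0
  have hs := scalar_ineq he0 he1
  have hκ1 : κ ≤ 1 := by linarith
  -- lower side: `(1 − T) ≥ (1 − e)`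
  have hlow : M ^ 3 * ((1 - e) * (π / 2 - 2 * e)) ≤ M ^ 3 * ((1 - T) * (π / 2 - 2 * e)) :=
    mul_le_mul_of_nonneg_left (mul_le_mul_of_nonneg_right (by linarith) (by linarith)) hM3.le
  -- split `κ·(P + X)` with `P ≤ 3eM³`
  have hX0 : 0 ≤ M ^ 3 * (π / 2 + 2 * e) / (1 - e) ^ 2 := by positivity
  have hP : κ * (64 * π ^ 3 * (e ^ 9 * θ ^ 2 * (1 + e) * U ^ 2 + U * M ^ 2) +
      (64 * π ^ 3 * (e ^ 9 * θ ^ 2 * (1 + e) * U ^ 3 + 3 * a * U ^ 3 * M + 3 * U ^ 2 * M ^ 2) +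
        (M ^ 3 * (π / 2 + 2 * e) / (1 - e) ^ 2 + M ^ 3 * (96 * (e ^ 9 * θ ^ 2 * (1 + e)) / e ^ 6)))) ≤
      3 * e * M ^ 3 + M ^ 3 * ((1 - 16 * e) * (π / 2 + 2 * e) * (1 + 3 * e)) := by
    have h1 : κ * (3 * e * M ^ 3) ≤ 3 * e * M ^ 3 := mul_le_of_le_one_left (by positivity) hκ1
    nlinarith [mul_le_mul_of_nonneg_left hpoly hκ0.le]
  have hfin : 3 * e * M ^ 3 + M ^ 3 * ((1 - 16 * e) * (π / 2 + 2 * e) * (1 + 3 * e)) +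
      e / 2 * M ^ 3 < M ^ 3 * ((1 - e) * (π / 2 - 2 * e)) := by
    nlinarith [mul_lt_mul_of_pos_left hs hM3]
  linarith

end RealInequality

end Summit.NavierStokesRegularity.NavierStokesRegularity.Theorems.Schatz2025
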